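import Mathlib
import Summits.NavierStokesRegularity.NavierStokesRegularity.Theses.RootDecompEpochRecut
import Summits.NavierStokesRegularity.NavierStokesRegularity.Theorems.RootDecompEpochRecutNoLateAtomStubLerayHopfLeftRadonRiesz
import HarnessLib

/-!
# RootDecompEpochRecut — aside RR `LerayHopfLeftRadonRiesz` (stmt-NavierStokesRegularity-30482) PROVED

Route N21 `route-NavierStokesRegularity-RootDecompEpochRecut` (lens-3 g7 «THE EPOCH RECUT»; writer g3), aside item
RR = STUB 2 of the crux NLA `NoLateAtom`'s first-prover skeleton. The registered stub
`Theorems.NoLateAtom.stub_lerayHopfLeftRadonRiesz` (landed p792627, census g24) has literally the item's text, so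
the route decl is closed by name: **Radon–Riesz in Leray's class at an epoch** — for a global Leray–Hopf flow
(force `0`, datum `u₀`, viscosity `ν > 0`) and `τ > 0`, energy continuity from the left at `τ` gives
`‖u t − u τ‖_{L²} → 0` as `t ↑ τ` (weak `L²`-continuity of the slices, a field of `IsLerayHopfOn τ`, + norm
convergence ⟹ strong convergence). Plumbing (the item's own docstring: «it should not fail — Radon–Riesz»);
the content of NLA is the energy-continuity half `ClayFlowEnergyContinuity` (open). Navier–Stokes regularity is
NOT proved by anything here (rung 0).
-/

-- the summit and its single sub-problem share the name (CONVENTIONS §1), as in every Theorems file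
set_option linter.dupNamespace false

namespace Summit.NavierStokesRegularity.NavierStokesRegularity.Theorems.NoLateAtom

/-- **Aside RR `LerayHopfLeftRadonRiesz` (stmt-NavierStokesRegularity-30482) holds**: the route decl
`Theses.RootDecompEpochRecut.LerayHopfLeftRadonRiesz`, closed by the registered stub
`stub_lerayHopfLeftRadonRiesz` (same text; Radon–Riesz in the Hilbert space `L²` along the weak
`L²`-continuity of Leray–Hopf slices). [folklore] -/
theorem lerayHopfLeftRadonRiesz_proof : Theses.RootDecompEpochRecut.LerayHopfLeftRadonRiesz := by
  unfold Theses.RootDecompEpochRecut.LerayHopfLeftRadonRiesz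
  exact stub_lerayHopfLeftRadonRiesz

end Summit.NavierStokesRegularity.NavierStokesRegularity.Theorems.NoLateAtom
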